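import Mathlib
import Summits.PneNP.PneNP.Theorems.SfmBlExistsAux
import Summits.PneNP.PneNP.Theorems.SfmBlSpotPackage
import Summits.PneNP.PneNP.Theorems.SfmBlSpotDecomposition
import Summits.PneNP.PneNP.Theorems.SfmBlCutFromTrace
import Summits.PneNP.PneNP.Theorems.SfmBlBlockSplit

/-!
# THEOREM M — cut-certified points EXIST at linear stretch (line «sfm-bl», PROOF-SFM-BL minus complexity)

FRONTIER F-N1c; nothing here bears on P vs NP.

`exists_cutCertified`: there is an absolute constant `C` (here `2^60`) such that for EVERY 3-local instance
`I : LocalMap 3 n m` with `0 < n` and `C·n ≤ m` some point `y ∈ {0,1}^m` is CUT-CERTIFIED, i.e. satisfies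
the defining inequality of `CandCutNorm.CutCertified I y` (written out, so that this file stays outside the
`Theses` import cone): for all `±1` vectors `σ, φ` on the variables,
`Σ_j χ(y_j)·σ(c_j)·(1 + φ(a_j) + φ(b_j)) < m`.  For pure-CAND instances such a point lies outside the range
(`CandCutNorm.cand_cut_certificate`); the conjecture `CandCutNormSigningFP` (stmt-PneNP-20523) asserts in
addition that such a point is computable in polynomial time — that FP layer is NOT addressed here.

This is NOT a counting triviality: being cut-certified is the CERTIFICATE property, and e.g. no point of an
instance whose outputs all share one class variable with pairwise distinct data variables is cut-certified.
The proof is the full mathematical pipeline of PROOF-SFM-BL with the kernel-checked bricks of the cell: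
block splitting into pieces of leg-degree `≤ L = 2^60` (`SfmBlBlockSplit`), spot extraction
(`exists_spot_decomposition_univ`), Prop. 7 on the sparse remainder with the §6 numerics (`remainder_package`:
`sum_trace_pow_le_legs` = Bilu–Linial 3.3 + Hoeffding + connected-set counting + Schur, constants of
`SfmBlNumerics`), Prop. 9 + Lemma 10 per spot (`spot_package`), the two-part potential with `y := argmin F`
(`min_two_part_bounds` — min ≤ average replaces the greedy of the algorithm), the root-free certificate return
(`abs_cut_le_of_trace_pow_le`) and free splitting (`cutCertified_of_matrix_cut_lt`, `bilin_le_sum_of_parts`).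
-/

namespace Summit.PneNP.PneNP.Theorems.SfmBl

open Matrix Finset BigOperators Literature.Computability.Complexity
open Summit.PneNP.PneNP.Theorems.CandCutNorm

/-- **THEOREM M (existence of cut-certified points at linear stretch `m ≥ 2^60·n`).** -/
theorem exists_cutCertified :
    ∃ C : ℕ, ∀ (n m : ℕ) (I : LocalMap 3 n m), 0 < n → C * n ≤ m →
      ∃ y : Fin m → Bool, ∀ (σ φ : Fin n → ℤ), (∀ i, σ i = 1 ∨ σ i = -1) → (∀ i, φ i = 1 ∨ φ i = -1) →
        ∑ j, boolSign (y j) * σ (I.vars j 0) * (1 + φ (I.vars j 1) + φ (I.vars j 2)) < (m : ℤ) := by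
  classical
  refine ⟨2 ^ 60, fun n m I hn hm => ?_⟩
  ------------------------------------------------------------------
  -- §0  legs, vertices, block splitting into pieces
  ------------------------------------------------------------------
  obtain ⟨vert₁, hvert₁⟩ : ∃ vert₁ : Fin m × Fin 3 → Fin n, vert₁ = fun e => I.vars e.1 0 := ⟨_, rfl⟩
  obtain ⟨vert₂, hvert₂⟩ : ∃ vert₂ : Fin m × Fin 3 → Option (Fin n),
      vert₂ = fun e => if e.2 = 0 then none else some (I.vars e.1 e.2) := ⟨_, rfl⟩
  obtain ⟨idx, hidx⟩ : ∃ idx : Fin m × Fin 3 → ℕ, idx = fun e => 3 * e.1.val + e.2.val := ⟨_, rfl⟩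
  have hidxinj : Function.Injective idx := by
    intro a b h
    rw [hidx] at h
    simp only at h
    have h1 : a.1.val = b.1.val := by have := a.2.isLt; have := b.2.isLt; omega
    have h2 : a.2.val = b.2.val := by omega
    exact Prod.ext (Fin.ext h1) (Fin.ext h2)
  have hL : 0 < (2 ^ 60 : ℕ) := Nat.pos_of_ne_zero (by norm_num)
  -- block counts and ranks (as in `SfmBlBlockSplit`)
  let nb₁ : Fin n → ℕ := fun v =>
    max 1 (((Finset.univ.filter fun e' : Fin m × Fin 3 => vert₁ e' = v).card + 2 ^ 60 - 1) / 2 ^ 60)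
  let nb₂ : Option (Fin n) → ℕ := fun v =>
    max 1 (((Finset.univ.filter fun e' : Fin m × Fin 3 => vert₂ e' = v).card + 2 ^ 60 - 1) / 2 ^ 60)
  let src : Fin m × Fin 3 → (Σ v : Fin n, Fin (nb₁ v)) := fun e =>
    ⟨vert₁ e, ⟨(Finset.univ.filter fun e' : Fin m × Fin 3 => vert₁ e' = vert₁ e ∧ idx e' < idx e).card / 2 ^ 60,
      fiberRank_div_lt vert₁ idx hL e⟩⟩
  let dst : Fin m × Fin 3 → (Σ v : Option (Fin n), Fin (nb₂ v)) := fun e =>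
    ⟨vert₂ e, ⟨(Finset.univ.filter fun e' : Fin m × Fin 3 => vert₂ e' = vert₂ e ∧ idx e' < idx e).card / 2 ^ 60,
      fiberRank_div_lt vert₂ idx hL e⟩⟩
  -- leg-degrees ≤ L
  have hdeg₁ : ∀ x : (Σ v : Fin n, Fin (nb₁ v)),
      (Finset.univ.filter fun e => src e = x).card ≤ 2 ^ 60 := by
    intro x
    refine le_trans (Finset.card_le_card fun e he => ?_) (card_block_le vert₁ idx hidxinj hL x.1 x.2.val)
    simp only [Finset.mem_filter, Finset.mem_univ, true_and] at he ⊢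
    subst he
    exact ⟨rfl, rfl⟩
  have hdeg₂ : ∀ x : (Σ v : Option (Fin n), Fin (nb₂ v)),
      (Finset.univ.filter fun e => dst e = x).card ≤ 2 ^ 60 := by
    intro x
    refine le_trans (Finset.card_le_card fun e he => ?_) (card_block_le vert₂ idx hidxinj hL x.1 x.2.val)
    simp only [Finset.mem_filter, Finset.mem_univ, true_and] at he ⊢
    subst he
    exact ⟨rfl, rfl⟩
  -- number of pieces
  have hdiv : (((m * 3) / 2 ^ 60 : ℕ) : ℝ) ≤ (m : ℝ) * 3 / 2 ^ 60 := by
    calc (((m * 3) / 2 ^ 60 : ℕ) : ℝ) ≤ ((m * 3 : ℕ) : ℝ) / ((2 ^ 60 : ℕ) : ℝ) := Nat.cast_div_le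
      _ = (m : ℝ) * 3 / 2 ^ 60 := by norm_num
  have hcardα : (Fintype.card (Σ v : Fin n, Fin (nb₁ v)) : ℝ) ≤ n + 3 * m / 2 ^ 60 := by
    have h0 := sum_blocks_le vert₁ hL
    rw [Fintype.card_fin, Fintype.card_prod, Fintype.card_fin, Fintype.card_fin] at h0
    have h1 : Fintype.card (Σ v : Fin n, Fin (nb₁ v)) ≤ n + (m * 3) / 2 ^ 60 := by
      rw [Fintype.card_sigma]
      simp only [Fintype.card_fin]
      exact h0
    have h1' : (Fintype.card (Σ v : Fin n, Fin (nb₁ v)) : ℝ) ≤ ((n + (m * 3) / 2 ^ 60 : ℕ) : ℝ) := by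
      exact_mod_cast h1
    rw [Nat.cast_add] at h1'
    linarith only [h1', hdiv]
  have hcardβ : (Fintype.card (Σ v : Option (Fin n), Fin (nb₂ v)) : ℝ) ≤ (n + 1) + 3 * m / 2 ^ 60 := by
    have h0 := sum_blocks_le vert₂ hL
    rw [Fintype.card_option, Fintype.card_fin, Fintype.card_prod, Fintype.card_fin, Fintype.card_fin] at h0
    have h1 : Fintype.card (Σ v : Option (Fin n), Fin (nb₂ v)) ≤ (n + 1) + (m * 3) / 2 ^ 60 := by
      rw [Fintype.card_sigma]
      simp only [Fintype.card_fin]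
      exact h0
    have h1' : (Fintype.card (Σ v : Option (Fin n), Fin (nb₂ v)) : ℝ)
        ≤ (((n + 1) + (m * 3) / 2 ^ 60 : ℕ) : ℝ) := by
      exact_mod_cast h1
    rw [Nat.cast_add, Nat.cast_add, Nat.cast_one] at h1'
    linarith only [h1', hdiv]
  set N : ℕ := Fintype.card (Σ v : Fin n, Fin (nb₁ v)) + Fintype.card (Σ v : Option (Fin n), Fin (nb₂ v))
    with hNdef
  have hN : ((Fintype.card (Σ v : Fin n, Fin (nb₁ v)) : ℝ)
      + Fintype.card (Σ v : Option (Fin n), Fin (nb₂ v))) ≤ 2 * n + 1 + 6 * m / 2 ^ 60 := by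
    linarith only [hcardα, hcardβ]
  have hN1 : 1 ≤ N := by
    have : 0 < Fintype.card (Σ v : Fin n, Fin (nb₁ v)) :=
      Fintype.card_pos_iff.2 ⟨⟨⟨0, hn⟩, ⟨0, lt_of_lt_of_le Nat.zero_lt_one (le_max_left 1 _)⟩⟩⟩
    omega
  ------------------------------------------------------------------
  -- the piece graph and the spot decomposition
  ------------------------------------------------------------------
  obtain ⟨Es, hEs⟩ : ∃ Es : (Σ v : Fin n, Fin (nb₁ v)) → (Σ v : Option (Fin n), Fin (nb₂ v)) → Prop,
      Es = fun i k => ∃ e, src e = i ∧ dst e = k := ⟨_, rfl⟩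
  haveI : DecidableRel (bipGraph Es).Adj := Classical.decRel _
  have hG : ∀ e, (bipGraph Es).Adj (Sum.inl (src e)) (Sum.inr (dst e)) := fun e =>
    (bipGraph_adj_inl_inr Es _ _).2 (by rw [hEs]; exact ⟨e, rfl, rfl⟩)
  have hGdeg : ∀ x, (bipGraph Es).degree x ≤ 2 ^ 60 := by
    intro x; subst hEs; exact degree_bipGraph_le src dst hdeg₁ hdeg₂ x
  have hγsp0 : (0 : ℝ) ≤ 60 * Real.sqrt (6000 * 2 ^ 60) := mul_nonneg (by norm_num) (Real.sqrt_nonneg _)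
  obtain ⟨r, p, V₁, V₂, hsp, hsides, hdense, -, hcov⟩ :=
    exists_spot_decomposition_univ src dst (bipGraph Es) hγsp0 (2 ^ (N + 5) + N)
  -- the part matrices of a signing
  obtain ⟨MpT, hMpT⟩ : ∃ MpT : (Fin m → Bool) → Option (Fin r) →
      Matrix (Σ v : Fin n, Fin (nb₁ v)) (Σ v : Option (Fin n), Fin (nb₂ v)) ℝ,
      MpT = fun T c i k => ∑ e ∈ Finset.univ.filter
        (fun e : Fin m × Fin 3 => src e = i ∧ dst e = k ∧ p e = c), ((boolSign (T e.1) : ℤ) : ℝ) :=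
    ⟨_, rfl⟩
  have hMpT' : ∀ T c i k, MpT T c i k = ∑ e ∈ (Finset.univ : Finset {e // p e = c}).filter
      (fun e => src e.1 = i ∧ dst e.1 = k), ((boolSign (T e.1.1) : ℤ) : ℝ) := by
    intro T c i k
    rw [hMpT, sum_part_eq₂ p c (fun e => src e = i) (fun e => dst e = k) (fun e => ((boolSign (T e.1) : ℤ) : ℝ))]
  ------------------------------------------------------------------
  -- the sparse remainder: Prop. 7 + numerics
  ------------------------------------------------------------------
  have hm' : 2 ^ 60 * n ≤ m := hm
  obtain ⟨rr, A₁, hrr, hA₁, hA₁r, hsum₁, hbudR⟩ := remainder_package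
    (fun e : {e // p e = none} => src e.1) (fun e => dst e.1) (fun e => e.1.1)
    (fun j => card_part_out_le_three p none j)
    (fun i => by
      rw [card_part_eq p none (fun e => src e = i)]
      exact le_trans (Finset.card_le_card fun e he => by
        simp only [Finset.mem_filter, Finset.mem_univ, true_and] at he ⊢; exact he.1) (hdeg₁ i))
    (fun k => by
      rw [card_part_eq p none (fun e => dst e = k)]
      exact le_trans (Finset.card_le_card fun e he => by
        simp only [Finset.mem_filter, Finset.mem_univ, true_and] at he ⊢; exact he.1) (hdeg₂ k))
    (bipGraph Es) (fun e => hG e.1) hGdeg hn hm' hN1 hN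
    (fun W₁ W₂ hconn hsize => by
      rw [card_part_eq₂ p none (fun e => src e ∈ W₁) (fun e => dst e ∈ W₂)]
      exact hsp W₁ W₂ hconn hsize)
    (fun T => MpT T none) (fun T i k => hMpT' T none i k)
  ------------------------------------------------------------------
  -- the spots: Prop. 9 + Lemma 10 packages
  ------------------------------------------------------------------
  have hL2 : (2 : ℝ) ≤ ((2 ^ 60 : ℕ) : ℝ) := by norm_num
  have hγ'0 : (0 : ℝ) ≤ Real.sqrt (6000 * 2 ^ 60) := Real.sqrt_nonneg _
  have hγ'L : 144 * ((2 ^ 60 : ℕ) : ℝ) * Real.log ((2 ^ 60 : ℕ) : ℝ) ≤ (Real.sqrt (6000 * 2 ^ 60)) ^ 2 := by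
    have e : ((2 ^ 60 : ℕ) : ℝ) = (2 : ℝ) ^ 60 := by norm_num
    rw [e]; exact sfmBl_gamma'_sq_ge
  have hpack := fun s : Fin r => spot_package
    (fun e : {e // p e = some s} => src e.1) (fun e => dst e.1) (fun e => e.1.1) (V₁ s) (V₂ s)
    (fun e => hsides s e.1 e.2) (fun j => card_part_out_le_three p (some s) j) hL
    (fun i => by
      rw [card_part_eq p (some s) (fun e => src e = i)]
      exact le_trans (Finset.card_le_card fun e he => by
        simp only [Finset.mem_filter, Finset.mem_univ, true_and] at he ⊢; exact he.1) (hdeg₁ i))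
    (fun k => by
      rw [card_part_eq p (some s) (fun e => dst e = k)]
      exact le_trans (Finset.card_le_card fun e he => by
        simp only [Finset.mem_filter, Finset.mem_univ, true_and] at he ⊢; exact he.1) (hdeg₂ k))
    hL2 hγ'0 hγ'L
    (by rw [card_part_univ p (some s)]; exact hdense s)
    (fun T => MpT T (some s)) (fun T i k => hMpT' T (some s) i k)
  choose hatS hhat0 hhatsum hspot using hpack
  -- abbreviate the constant `L⁻¹⁰`
  obtain ⟨Lc, hLc⟩ : ∃ Lc : ℝ, Lc = (((2 ^ 60 : ℕ) : ℝ) ^ 10)⁻¹ := ⟨_, rfl⟩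
  simp only [← hLc] at hhatsum
  have hL10 : (0 : ℝ) ≤ Lc := by rw [hLc]; exact inv_nonneg.2 (pow_nonneg (Nat.cast_nonneg _) 10)
  have hLc_le : Lc ≤ (1 : ℝ) / 28800 := by
    have hbig : (28800 : ℝ) ≤ ((2 ^ 60 : ℕ) : ℝ) ^ 10 := by
      have hcast : ((2 ^ 60 : ℕ) : ℝ) = (2 : ℝ) ^ 60 := by norm_num
      rw [hcast]
      calc (28800 : ℝ) ≤ (2 : ℝ) ^ 60 := by norm_num
        _ ≤ ((2 : ℝ) ^ 60) ^ 10 := le_self_pow₀ (by norm_num) (by norm_num)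
    rw [hLc, inv_eq_one_div]
    exact one_div_le_one_div_of_le (by norm_num) hbig
  ------------------------------------------------------------------
  -- the potential and its minimiser
  ------------------------------------------------------------------
  obtain ⟨Q₀, hQ₀⟩ : ∃ Q₀ : ℝ,
      Q₀ = ∑ s : Fin r, 4 * (((V₁ s).card : ℝ) + (V₂ s).card) * Lc := ⟨_, rfl⟩
  have hQ₀0 : 0 ≤ Q₀ := by
    rw [hQ₀]
    refine Finset.sum_nonneg fun s _ => mul_nonneg (mul_nonneg (by norm_num) ?_) hL10
    exact add_nonneg (Nat.cast_nonneg _) (Nat.cast_nonneg _)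
  let trR : (Fin m → Bool) → ℝ := fun T =>
    ((Matrix.fromBlocks 0 (MpT T none) (MpT T none)ᵀ 0) ^ (2 ^ ((N + 4) + 2))).trace
  let hat : (Fin m → Bool) → ℝ := fun T => ∑ s, hatS s T
  have hexp : 2 ^ ((N + 4) + 2) = 2 * 2 ^ (N + 5) := by rw [pow_succ]; ring
  have htr0 : ∀ T, 0 ≤ trR T := fun T => by
    show 0 ≤ ((Matrix.fromBlocks 0 (MpT T none) (MpT T none)ᵀ 0) ^ (2 ^ ((N + 4) + 2))).trace
    rw [hexp]; exact trace_fromBlocks_pow_two_mul_nonneg _ _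
  have hhat0' : ∀ T, 0 ≤ hat T := fun T => Finset.sum_nonneg fun s _ => hhat0 s T
  have hsum₂ : ∑ T, hat T ≤ 2 ^ m * Q₀ := by
    show ∑ T, ∑ s, hatS s T ≤ 2 ^ m * Q₀
    rw [Finset.sum_comm, hQ₀, Finset.mul_sum]
    exact Finset.sum_le_sum fun s _ => hhatsum s
  obtain ⟨F, hF⟩ : ∃ F : (Fin m → Bool) → ℝ, F = fun T => trR T / A₁ + hat T / (6 / 5 * (Q₀ + 1)) :=
    ⟨_, rfl⟩
  obtain ⟨y, -, hy⟩ := Finset.exists_min_image Finset.univ F Finset.univ_nonempty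
  obtain ⟨htrA, hhatA⟩ := min_two_part_bounds trR hat F htr0 hhat0' hA₁ hQ₀0 (fun T => by rw [hF])
    hsum₁ hsum₂ y (fun T => hy T (Finset.mem_univ T))
  refine ⟨y, ?_⟩
  ------------------------------------------------------------------
  -- per-part cut bounds for `y`
  ------------------------------------------------------------------
  have htrace : ((Matrix.fromBlocks 0 (MpT y none) (MpT y none)ᵀ 0) ^ (2 ^ ((N + 4) + 2))).trace
      ≤ rr ^ (2 ^ ((N + 4) + 2)) := le_trans htrA.le hA₁r
  have hR : ∀ (σ : (Σ v : Fin n, Fin (nb₁ v)) → ℝ) (φ : (Σ v : Option (Fin n), Fin (nb₂ v)) → ℝ),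
      (∀ i, σ i = 1 ∨ σ i = -1) → (∀ k, φ k = 1 ∨ φ k = -1) →
      σ ⬝ᵥ (MpT y none *ᵥ φ) ≤ ((Fintype.card (Σ v : Fin n, Fin (nb₁ v)) : ℝ)
        + Fintype.card (Σ v : Option (Fin n), Fin (nb₂ v))) * rr / 2 := by
    intro σ φ hσ hφ
    have h := abs_cut_le_of_trace_pow_le (MpT y none) σ φ hσ hφ (N + 4) hrr htrace
    exact (le_abs_self _).trans h
  let X : Option (Fin r) → ℝ := fun c =>
    match c with
    | none => ((Fintype.card (Σ v : Fin n, Fin (nb₁ v)) : ℝ)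
        + Fintype.card (Σ v : Option (Fin n), Fin (nb₂ v))) * rr / 2
    | some s => (Fintype.card {e // p e = some s} : ℝ) / 30 + hatS s y
  have hX : ∀ c (σ : (Σ v : Fin n, Fin (nb₁ v)) → ℝ) (φ : (Σ v : Option (Fin n), Fin (nb₂ v)) → ℝ),
      (∀ i, σ i = 1 ∨ σ i = -1) → (∀ k, φ k = 1 ∨ φ k = -1) → σ ⬝ᵥ (MpT y c *ᵥ φ) ≤ X c := by
    intro c σ φ hσ hφ
    cases c with
    | none => exact hR σ φ hσ hφ
    | some s => exact (hspot s y σ φ hσ hφ).le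
  ------------------------------------------------------------------
  -- the budget
  ------------------------------------------------------------------
  have hmreal : (2 : ℝ) ^ 60 ≤ m := by
    have h1 : ((2 ^ 60 * n : ℕ) : ℝ) ≤ m := by exact_mod_cast hm
    have h2 : (1 : ℝ) ≤ n := by exact_mod_cast hn
    push_cast at h1
    have h3 : (2 : ℝ) ^ 60 * 1 ≤ 2 ^ 60 * n := mul_le_mul_of_nonneg_left h2 (by norm_num)
    linarith only [h1, h3]
  have hspots : ∑ s : Fin r, (Fintype.card {e // p e = some s} : ℝ) ≤ 3 * m := by
    have h1 := sum_card_parts_le p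
    rw [Fintype.card_prod, Fintype.card_fin, Fintype.card_fin] at h1
    have h2 : ∀ s : Fin r, (Fintype.card {e // p e = some s} : ℝ)
        = ((Finset.univ.filter fun e => p e = some s).card : ℝ) := fun s => by rw [card_part_univ]
    simp only [h2]
    have h3 : ((∑ s : Fin r, (Finset.univ.filter fun e => p e = some s).card : ℕ) : ℝ) ≤ ((m * 3 : ℕ) : ℝ) := by
      exact_mod_cast h1
    push_cast at h3
    linarith only [h3]
  have hQ₀le : Q₀ ≤ 24 * m * Lc := by
    rw [hQ₀, ← Finset.sum_mul]
    refine mul_le_mul_of_nonneg_right ?_ hL10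
    have h1 : ∀ s : Fin r, 4 * (((V₁ s).card : ℝ) + (V₂ s).card)
        ≤ 8 * (Fintype.card {e // p e = some s} : ℝ) := by
      intro s
      have := hcov s
      rw [card_part_univ]
      have h' : (((V₁ s).card : ℝ) + (V₂ s).card) ≤ 2 * ((Finset.univ.filter fun e => p e = some s).card : ℝ) := by
        exact_mod_cast this
      linarith only [h']
    calc ∑ s, 4 * (((V₁ s).card : ℝ) + (V₂ s).card) ≤ ∑ s, 8 * (Fintype.card {e // p e = some s} : ℝ) :=
          Finset.sum_le_sum fun s _ => h1 s
      _ = 8 * ∑ s, (Fintype.card {e // p e = some s} : ℝ) := by rw [Finset.mul_sum]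
      _ ≤ 24 * m := by linarith only [hspots]
  have hA₃ : 6 / 5 * (Q₀ + 1) ≤ 0.001 * m + 1.2 := by
    have hm0 : (0 : ℝ) ≤ 24 * m := mul_nonneg (by norm_num) (Nat.cast_nonneg m)
    have h2 : Q₀ ≤ 24 * m * (1 / 28800) := hQ₀le.trans (mul_le_mul_of_nonneg_left hLc_le hm0)
    linarith only [h2]
  have hbud : ∑ c, X c < m := by
    rw [Fintype.sum_option]
    simp only [X]
    rw [Finset.sum_add_distrib]
    have h1 : ∑ s : Fin r, (Fintype.card {e // p e = some s} : ℝ) / 30 ≤ 0.1 * m := by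
      rw [← Finset.sum_div]; linarith only [hspots]
    have h2 : ∑ s : Fin r, hatS s y < 6 / 5 * (Q₀ + 1) := hhatA
    linarith only [h1, h2, hbudR, hA₃, hmreal]
  ------------------------------------------------------------------
  -- free splitting: from the part bounds to the certificate
  ------------------------------------------------------------------
  have hz0 : ∀ j : Fin m, vert₂ (j, 0) = none := fun j => by rw [hvert₂]; simp
  have hz1 : ∀ j : Fin m, vert₂ (j, 1) = some (I.vars j 1) := fun j => by
    rw [hvert₂]; simp [show (1 : Fin 3) ≠ 0 by decide]
  have hz2 : ∀ j : Fin m, vert₂ (j, 2) = some (I.vars j 2) := fun j => by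
    rw [hvert₂]; simp [show (2 : Fin 3) ≠ 0 by decide]
  refine cutCertified_of_matrix_cut_lt I y src dst Sigma.fst Sigma.fst
    (fun j ℓ => by show vert₁ (j, ℓ) = I.vars j 0; rw [hvert₁]) (fun j => hz0 j) (fun j => hz1 j)
    (fun j => hz2 j)
    (fun i k => ∑ e ∈ Finset.univ.filter (fun e : Fin m × Fin 3 => src e = i ∧ dst e = k),
      ((boolSign (y e.1) : ℤ) : ℝ)) (fun i k => rfl) ?_
  intro σ' φ' hσ' hφ'
  have h := bilin_le_sum_of_parts src dst (fun e => ((boolSign (y e.1) : ℤ) : ℝ)) p _ (fun i k => rfl)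
    (MpT y) (fun c i k => by rw [hMpT]) σ' φ' X (fun c => hX c σ' φ' hσ' hφ')
  exact lt_of_le_of_lt h hbud

end Summit.PneNP.PneNP.Theorems.SfmBl
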